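import Literature.Topology.FourManifolds.FlatHost
import Literature.Topology.FourManifolds.WallHost
import HarnessLib

/-!
# The chord host of a flat host: the reflected host of a flip frame over another circle

Topic `Literature/Topology/FourManifolds` (trunk T-4MAN). Fact seat
`provefact-Literature.Topology.FourManifolds.Knot.IsConnectedSum.isIsotopic` (Schubert's theorem),
geometric heart for rail knots, third segment conjugation. The construction of `ChordHost.lean`
with the flip knot `flipKnot 1` replaced by the host `H₁.host 1` of the flip frame of a flip pair
`(b₁, b₂)` at flat scale (`FlatHost.FlatHyp`): the knot `X = R ∘ H₁.host 1`, reparametrised over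
the circle of another datum `b` by the chord lift of `ChordHost.lean`, is the **chord host**
`chordHostZ`; on the straight parameters `[strLo, strHi]` of `b` it is the chord of `b₂` with the
clock of `b` (`chordHostZ_circlePt_of_mem`), because on the chord sub-zone of the upper core of
`b₁` the host is the flip frame, whose reflection is the chord (`FlipWall.flipSpikedC_one_chord`).
Also: the wall reference of a flat host (`FlatHyp.wallRef`).

Everything is proved; no named facts are introduced.

## References

* M. W. Hirsch, *Differential Topology*, GTM 33 (1976), Ch. 8 §1, Thm. 1.3. [HirschDT1976]
-/

open scoped Manifold ContDiff Topology Real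
open Function Set Metric Filter

noncomputable section

namespace Literature.Topology.FourManifolds

/-- Local notation: `𝔼 n` is the model Euclidean space `EuclideanSpace ℝ (Fin n)`. -/
local notation "𝔼 " n:arg => EuclideanSpace ℝ (Fin n)

/-- Local notation: `𝕊 n` is the unit sphere in `EuclideanSpace ℝ (Fin (n + 1))`. -/
local notation "𝕊 " n:arg => (Metric.sphere (0 : EuclideanSpace ℝ (Fin (n + 1))) 1)

attribute [local instance] fact_finrank_euclideanSpace_succ

open KnotsInBall ExitBend

namespace BandData

namespace FlatHyp

variable {A₁ B₁ K₁ : Knot} {b₁ : BandData A₁ B₁ K₁ ∅} {A₂ B₂ K₂ : Knot} {b₂ : BandData A₂ B₂ K₂ ∅}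
  {hcross₁ : b₁.band ⁻¹' sphereEquator 2 ∩ squareNhd b₁.δ = {x ∈ squareNhd b₁.δ | x 0 = 2⁻¹}}
  {hcross₂ : b₂.band ⁻¹' sphereEquator 2 ∩ squareNhd b₂.δ = {x ∈ squareNhd b₂.δ | x 0 = 2⁻¹}}
  {ε₁ r₁ A₁' ε₂ r₂ ε₁' r₁' κ₁ : ℝ} (H₁ : FlatHyp hcross₁ hcross₂ ε₁ r₁ A₁' ε₂ r₂ ε₁' r₁' κ₁)

/-- **The wall reference of a flat host** at parameter `u`. [folklore] -/
theorem wallRef {u : ℝ} (hu : u ∈ Icc (0 : ℝ) 1) : b₁.WallRef hcross₁ ε₁ r₁ A₁' κ₁ (H₁.frame u) :=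
  ⟨H₁.HU, H₁.isWallFrame hu, H₁.isBendClear hu, fun _ ht ↦ H₁.frame_eq_spikePiece u ht, H₁.hA, H₁.hB, H₁.hAB⟩

/-- The reference host of the wall reference is the host. [folklore] -/
theorem wallRef_host {u : ℝ} (hu : u ∈ Icc (0 : ℝ) 1) : (H₁.wallRef hu).host = H₁.host hu := rfl

/-- **The reflected host at `u = 1`**: `X = R ∘ H₁.host 1`. [folklore] -/
def hostR : Knot := (H₁.host one_mem01).map (reflectLastDiffeo 3)

/-- **On the chord sub-zone of the upper core of `b₁` the reflected host is the chord of `b₂`**: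
`X (circlePt s) = ψ⁻¹ (chordLine κ₁ (-αHi₁ s))` (`-αHi₁ s ∈ [3/2, 5/2]`). [folklore] -/
theorem hostR_circlePt_of_chord {s : ℝ} (hc : s ∈ Icc (b₁.tcHi - b₁.epsHi / 8) (b₁.tcHi + b₁.epsHi / 8))
    (hα : -b₁.alphaHi κ₁ s ∈ Icc (3 / 2 : ℝ) (5 / 2)) :
    H₁.hostR (circlePt s) = psiN.symm (b₂.chordLine κ₁ (-b₁.alphaHi κ₁ s)) := by
  have hκ := H₁.κ_pos
  obtain ⟨-, -, -, -, m5, m6, m7, -, -, -, -, -⟩ := H₁.marks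
  obtain ⟨c1, c2, c3⟩ := b₁.core_marks
  have hjhs : b₁.alphaHi κ₁ H₁.jHi = 3 / 8 := (b₁.juncHi_spec hκ H₁.h7').2
  have hjh : H₁.jHi ∈ Icc (b₁.tcHi - b₁.epsHi / 8) (b₁.tcHi + b₁.epsHi / 8) := b₁.juncHi_mem_core hκ H₁.h7'
  have hsj : H₁.jHi < s := by
    by_contra hle; push Not at hle
    have := (b₁.strictAntiOn_alphaHi hκ).antitoneOn hc hjh hle
    rw [hjhs] at this; linarith [hα.1]
  have hsI : s ∈ Ico b₁.alo (b₁.alo + 1) := ⟨by linarith [hc.1, b₁.epsLo_bounds.1], by linarith [hc.2]⟩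
  have e1 : H₁.host one_mem01 (circlePt s) = reflectLast 3 (psiN.symm (b₂.chordLine κ₁ (-b₁.alphaHi κ₁ s))) := Subtype.ext (by
    rw [H₁.coe_host_circlePt, H₁.hostLoop_eq_bent one_mem01 hsI (fun h ↦ by linarith [h.2]),
      H₁.coe_bent_of_not_mem one_mem01 hsI (fun h ↦ by linarith [h.2])]
    exact flipSpikedC_one_chord H₁.arc H₁.HU.cone hc hα)
  rw [hostR, SphereEmbedding.map_apply, coe_reflectLastDiffeo, e1, reflectLast_reflectLast]

end FlatHyp

/-! ### The chord host over the circle of `b` -/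

section ChordZ

variable {A B K : Knot} (b : BandData A B K ∅)
  {hcross : b.band ⁻¹' sphereEquator 2 ∩ squareNhd b.δ = {x ∈ squareNhd b.δ | x 0 = 2⁻¹}}
  {ε r A' κ lam₀ : ℝ} (HU : b.ShrinkScaleU hcross ε r A' κ) (hl : lam₀ ∈ Ioc (0 : ℝ) 1) (hl2 : lam₀ ≤ 1 / 2)
  {A₁ B₁ K₁ : Knot} {b₁ : BandData A₁ B₁ K₁ ∅} {A₂ B₂ K₂ : Knot} {b₂ : BandData A₂ B₂ K₂ ∅}
  {hcross₁ : b₁.band ⁻¹' sphereEquator 2 ∩ squareNhd b₁.δ = {x ∈ squareNhd b₁.δ | x 0 = 2⁻¹}}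
  {hcross₂ : b₂.band ⁻¹' sphereEquator 2 ∩ squareNhd b₂.δ = {x ∈ squareNhd b₂.δ | x 0 = 2⁻¹}}
  {ε₁ r₁ A₁' ε₂ r₂ ε₁' r₁' κ₁ : ℝ} (H₁ : FlatHyp hcross₁ hcross₂ ε₁ r₁ A₁' ε₂ r₂ ε₁' r₁' κ₁)

/-- **The chord host loop**: the curve of the reflected host through the chord lift. [folklore] -/
def chordHostZLoop : ℝ → 𝔼 4 := Knot.curve H₁.hostR ∘ b.chordLift HU hl hl2 H₁.HU

/-- The chord host loop is a regular loop. [folklore] -/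
theorem isRegularLoop_chordHostZLoop : IsRegularLoop (b.chordHostZLoop HU hl hl2 H₁) :=
  H₁.hostR.isRegularLoop_curve.comp_lift (b.isLift_chordLift HU hl hl2 H₁.HU)

/-- The chord host loop is simple. [folklore] -/
theorem simple_chordHostZLoop : ∀ s t, b.chordHostZLoop HU hl hl2 H₁ s = b.chordHostZLoop HU hl hl2 H₁ t → ∃ m : ℤ, t - s = m :=
  IsRegularLoop.simple_comp_lift (b.isLift_chordLift HU hl hl2 H₁.HU) H₁.hostR.simple_curve

/-- **THE CHORD HOST**: the reflected host `R ∘ H₁.host 1` reparametrised over the circle of `b`.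
[folklore] -/
def chordHostZ : Knot := (b.isRegularLoop_chordHostZLoop HU hl hl2 H₁).toKnot (b.simple_chordHostZLoop HU hl hl2 H₁)

/-- **The chord host is isotopic to the reflected host.**
[cite: HirschDT1976, Ch. 8, Thm. 8.1.3 (p. 180) and proof of Thm. 8.3.3 (p. 186)] -/
theorem isIsotopic_chordHostZ_hostR : (b.chordHostZ HU hl hl2 H₁).IsIsotopic H₁.hostR := by
  have h := H₁.hostR.isRegularLoop_curve.isIsotopic_toKnot_comp_lift (b.isLift_chordLift HU hl hl2 H₁.HU) H₁.hostR.simple_curve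
  rw [Knot.toKnot_curve] at h
  exact h

/-- The chord host through `circlePt t` is the chord host loop at `t`. [folklore] -/
theorem coe_chordHostZ_circlePt (t : ℝ) :
    ((b.chordHostZ HU hl hl2 H₁ (circlePt t) : 𝕊 3) : 𝔼 4) = Knot.curve H₁.hostR (b.chordLift HU hl hl2 H₁.HU t) :=
  (b.isRegularLoop_chordHostZLoop HU hl hl2 H₁).coe_toKnot_circlePt _ t

/-- The chord host at a parameter is the reflected host at the lifted parameter. [folklore] -/
theorem chordHostZ_circlePt (t : ℝ) : b.chordHostZ HU hl hl2 H₁ (circlePt t) = H₁.hostR (circlePt (b.chordLift HU hl hl2 H₁.HU t)) :=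
  Subtype.ext (by rw [b.coe_chordHostZ_circlePt, Knot.curve_apply])

include hl in
/-- **THE CHORD HOST ON THE STRAIGHT PARAMETERS OF `b` IS THE CHORD OF `b₂` WITH THE CLOCK OF `b`**:
`chordHostZ (circlePt u) = ψ⁻¹ (o' + clockFn u • d')`. [folklore] -/
theorem chordHostZ_circlePt_of_mem {u : ℝ} (hu : u ∈ Icc (b.strLo HU) (b.strHi HU)) :
    b.chordHostZ HU hl hl2 H₁ (circlePt u) = psiN.symm (chordO H₁.arc + b.clockFn HU hl hl2 u • chordD H₁.arc) := by
  obtain ⟨m1, m2, m3, m3', m4, m5⟩ := b.str_marks HU hl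
  have hz : u ∈ Ioo (b.zoneLo HU) (b.zoneHi HU) := ⟨by linarith [hu.1], by linarith [hu.2]⟩
  obtain ⟨-, hcore, hlev⟩ := b.chordPar_zone HU hl hl2 H₁.HU hz
  have hcv := b.clockFn_str HU hl hl2 hu
  rw [b.chordHostZ_circlePt, b.chordLift_of_mem HU hl hl2 H₁.HU hu,
    H₁.hostR_circlePt_of_chord hcore (by rw [hlev]; simp only [chordLev]; constructor <;> linarith [hcv.1, hcv.2]), hlev, chordLev,
    neg_neg, chordLine_chordLev]

end ChordZ

end BandData

end Literature.Topology.FourManifolds
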